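import Literature.Claims.NS.Lietz2026
import Mathlib.NumberTheory.Real.GoldenRatio
import HarnessLib

/-!
# NS-claims map, C167 (Lietz 2026): Lemma 6.2's «Fibonacci germ corridor» bound is TRUE —
# `r_k = 1/(F_{k+1}F_{k+2}) ≤ φ² · φ^{−2k}` (salvage, kernel)

Claim C167 of cell `ns-claims` (D-0090): Justin K. Lietz, *A Phase Calculus Proof of Global Regularity
for the Three-Dimensional Navier–Stokes Equations*, Zenodo record 20091655 (bib `Lietz2026`), skeleton
`Literature.Claims.NS.Lietz2026` (typist ns-claims-typist-7 g8).  Lemma 6.2 (31) p.6 l.27–p.7 l.25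
(«B^k(1,1) = (F_{k+1}, F_{k+2}), r_k = 1/(F_{k+1}F_{k+2}) … r_k ≤ C_r φ^{−2k}») is typed in two parts:
`Step_L62a` (the matrix identity, PROVED in the skeleton) and `Step_L62b`
(`∃ C_r > 0, ∀ k, rFib k ≤ C_r · phi ^ (−2k)`, left open there).  We prove `Step_L62b` with
`C_r = φ²` from the elementary bound `φ^n ≤ F_{n+2}` (induction on `φ² = φ + 1`; Mathlib's
`Real.goldenRatio`, which is the skeleton's `phi` by `rfl`).  The statement is Fibonacci folklore and
carries no Navier–Stokes content; the located step of the row is the refuter's.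

* `step_L62b_holds : Literature.Claims.NS.Lietz2026.Step_L62b`.

Records-grade TRUE-column object; announce-first honoured (typist-7 g8's skeleton: «not proved here»).
Salvage seat ns-claims-salvage-p4 g4.  Axioms: `propext`, `Classical.choice`, `Quot.sound` only.
WHAT THIS IS NOT: not a claim about NS regularity or blow-up; not a claim about any author beyond
the typed locator.
-/

noncomputable section

open Real
open scoped goldenRatio

-- The summit's canonical theorem namespace repeats the summit name (single-conjunct summit).
set_option linter.dupNamespace false

namespace Summit.NavierStokesRegularity.NavierStokesRegularity.Theorems.Lietz2026

open Literature.Claims.NS.Lietz2026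

/-- **Golden-ratio lower bound for Fibonacci numbers**: `φ^n ≤ F_{n+2}` (induction with `φ² = φ + 1`). [folklore] -/
theorem goldenRatio_pow_le_fib_add_two (n : ℕ) : φ ^ n ≤ (Nat.fib (n + 2) : ℝ) := by
  induction n using Nat.twoStepInduction with
  | zero => simp [Nat.fib_two]
  | one =>
    have : (Nat.fib (1 + 2) : ℝ) = 2 := by norm_num [Nat.fib_add_two]
    rw [pow_one, this]
    linarith [goldenRatio_lt_two]
  | more n h0 h1 =>
    have hrec : (Nat.fib (n + 2 + 2) : ℝ) = Nat.fib (n + 2) + Nat.fib (n + 1 + 2) := by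
      rw [show n + 2 + 2 = (n + 2) + 2 from rfl, Nat.fib_add_two]
      push_cast; ring_nf
    rw [hrec]
    have hsq : φ ^ (n + 2) = φ ^ n + φ ^ (n + 1) := by
      have := goldenRatio_sq
      calc φ ^ (n + 2) = φ ^ n * φ ^ 2 := by ring
        _ = φ ^ n * (φ + 1) := by rw [this]
        _ = φ ^ n + φ ^ (n + 1) := by ring
    rw [hsq]
    exact add_le_add h0 h1

/-- **Lemma 6.2's corridor bound holds**: `r_k = 1/(F_{k+1}F_{k+2}) ≤ C_r φ^{−2k}` with `C_r = φ²`
(`F_{k+1} F_{k+2} ≥ φ^{k−1} φ^{k} = φ^{2k−1} ≥ φ^{2k−2}`). Pure number theory — no Navier–Stokes content.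
[cite: Lietz2026, Lemma 6.2 (31) p.6 l.27–p.7 l.25] -/
theorem step_L62b_holds : Step_L62b := by
  refine ⟨φ ^ 2, by positivity, fun k => ?_⟩
  have hφ := goldenRatio_pos
  have hphi : phi = φ := rfl
  -- `phi ^ (-(2k)) = (φ ^ (2k))⁻¹` as a real power
  have hpow : phi ^ (-(2 * (k : ℝ))) = (φ ^ (2 * k))⁻¹ := by
    rw [hphi, Real.rpow_neg hφ.le, show (2 * (k : ℝ)) = ((2 * k : ℕ) : ℝ) by push_cast; ring,
      Real.rpow_natCast]
  rw [hpow, rFib, one_div]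
  have h1 : (0 : ℝ) < Nat.fib (k + 1) := by exact_mod_cast Nat.fib_pos.2 (Nat.succ_pos k)
  have h2 : (0 : ℝ) < Nat.fib (k + 2) := by exact_mod_cast Nat.fib_pos.2 (Nat.succ_pos (k + 1))
  rcases Nat.eq_zero_or_pos k with rfl | hk
  · have e1 : (Nat.fib (0 + 1) : ℝ) = 1 := by norm_num
    have e2 : (Nat.fib (0 + 2) : ℝ) = 1 := by norm_num [Nat.fib_two]
    rw [e1, e2, mul_one, inv_one, mul_zero, pow_zero, inv_one, mul_one]
    nlinarith [one_lt_goldenRatio]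
  · obtain ⟨m, rfl⟩ := Nat.exists_eq_add_of_le hk
    have hA : φ ^ m ≤ (Nat.fib (1 + m + 1) : ℝ) := by
      rw [show 1 + m + 1 = m + 2 by ring]; exact goldenRatio_pow_le_fib_add_two m
    have hB : φ ^ (m + 1) ≤ (Nat.fib (1 + m + 2) : ℝ) := by
      rw [show 1 + m + 2 = (m + 1) + 2 by ring]; exact goldenRatio_pow_le_fib_add_two (m + 1)
    have hprod : φ ^ m * φ ^ (m + 1) ≤ (Nat.fib (1 + m + 1) : ℝ) * Nat.fib (1 + m + 2) :=
      mul_le_mul hA hB (pow_nonneg hφ.le _) (by positivity)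
    have hpos : 0 < φ ^ m * φ ^ (m + 1) := by positivity
    -- `φ² (φ^{2(1+m)})⁻¹ = (φ^{2m})⁻¹ ≥ (φ^{2m+1})⁻¹ = (φ^m φ^{m+1})⁻¹ ≥ (F F)⁻¹`
    have hRHS : φ ^ 2 * (φ ^ (2 * (1 + m)))⁻¹ = (φ ^ (2 * m))⁻¹ := by
      have hφ0 : φ ≠ 0 := goldenRatio_ne_zero
      field_simp
      ring
    have hle : φ ^ (2 * m) ≤ φ ^ m * φ ^ (m + 1) := by
      rw [← pow_add, show m + (m + 1) = 2 * m + 1 by ring, pow_succ]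
      exact le_mul_of_one_le_right (pow_nonneg hφ.le _) one_lt_goldenRatio.le
    calc ((Nat.fib (1 + m + 1) : ℝ) * Nat.fib (1 + m + 2))⁻¹ ≤ (φ ^ m * φ ^ (m + 1))⁻¹ :=
          inv_anti₀ hpos hprod
      _ ≤ (φ ^ (2 * m))⁻¹ := inv_anti₀ (by positivity) hle
      _ = φ ^ 2 * (φ ^ (2 * (1 + m)))⁻¹ := hRHS.symm

end Summit.NavierStokesRegularity.NavierStokesRegularity.Theorems.Lietz2026

end
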